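import Literature.Computability.MetaComplexity.DPHybrid
import Literature.Computability.MetaComplexity.DPReconstructionGL
import HarnessLib

/-!
# Complexity meta: one run of the advice reconstruction for `DP_k` on strings (Hirahara 2021, Lemma 3.14)

Topic `Literature/Computability/MetaComplexity`, string layer over the math layer `DPHybrid.lean`
(Hirahara, ECCC TR21-058, Lemma 3.14: the hybrid argument with a `k`-bit advice). For a test
`T : {0,1}^{kn+k} → Bool` on samples `z ‖ bits` of the direct product generator `DP_k` (Def. 3.10,
`DirectProductGenerator.lean`):

* `DPHybStr.hybPred T n j sgn ω' u α` — **Yao's predictor on strings**: on a query `r ∈ {0,1}ⁿ` run the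
  test on (the blocks `ω'` with block `j` replaced by `r`) ‖ (the advice `α`, then the coins `u` from
  position `j` on), and answer `¬(u_j ⊕ sgn ⊕ T(…))`;
* `DPHybStr.hrun T n k kk j sgn α w` — **one run of the reconstruction** `R(α; w)`: parse the coins
  `w = ω' ‖ u ‖ S ‖ τ` (lengths `kn, k, kk·n, kk`) and output Rackoff's candidate
  `candStr n kk (hybPred …) S τ` (the Goldreich–Levin decoder of `GoldreichLevinDecoder.lean`);
* `DPHybStr.advice x n j w` — **the advice function** `A(x; w)`: the `j` inner products of `x` with the
  first `j` blocks of `ω'` (`glBits j n x ω'`);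
* `bz_hybPred` — the string predictor IS `DPHyb.predZ` on encoded data; `hrun_split`;
* `card_success_ge`, **`exists_uniformProb_hrun_ge`** — if `T` `δ`-distinguishes `DP_k(x; ·)` from
  uniform (`dpAdvantage ≥ δ`) and `2^kk − 1 ≥ n/(2(δ/4k)²)`, then for some block `j < k` and sign
  `sgn`, `Pr_w[R(A(x; w); w) = x] ≥ δ/(8k·2^kk)` over coins of any length `≥ kn + k + kk·n + kk`
  (Lemma 3.14: "`Pr_w[R^D(A(x, w), w) = x] ≥ 1/poly(n/δ)`"), by `DPHyb.reconstruction_count`.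

## References

* S. Hirahara, ECCC TR21-058 (2021), Lemma 3.14 and its proof (pp. 23–24), Thm. 3.12, Def. 3.10.
* O. Goldreich, L. A. Levin, STOC 1989; S. Arora, B. Barak, CUP 2009, Thm. 9.12 (Rackoff's decoder).
-/

noncomputable section

namespace Literature.Computability.MetaComplexity

open _root_.Computability Complexity Complexity.Stockmeyer Finset Matrix
open Literature.Computability.Cryptography Cryptography.AffineStr Cryptography.GLEns Cryptography.GLDec Cryptography.GLInv

namespace DPHybStr

variable {n k : ℕ}

/-! ### The predictor, the run and the advice on strings -/

/-- **Yao's predictor on strings** (`= DPHyb.predZ` on encoded data, `bz_hybPred`): blocks `ω'` with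
block `j` replaced by the query `r` (read to length `n`, as the program's masked-xor plumbing does),
then the bits `α ‖ u ⇂ j`, fed to the test; answer `¬(u_j ⊕ sgn ⊕ T(…))`.
[cite: Hirahara2021, Lemma 3.14 (proof)] -/
def hybPred (T : List Bool → Bool) (n j : ℕ) (sgn : Bool) (ω' u α : List Bool) (r : List Bool) : Bool :=
  !(Bool.xor (u.getD j false) (Bool.xor sgn (T (ω'.take (j * n) ++ r.take n ++ ω'.drop ((j + 1) * n) ++ (α ++ u.drop j)))))

/-- **One run of the reconstruction `R(α; w)`** on coins `w = ω' ‖ u ‖ S ‖ τ ‖ (unused)`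
(lengths `kn, k, kk·n, kk`): Rackoff's candidate for the string predictor. [cite: Hirahara2021, Lemma 3.14] -/
def hrun (T : List Bool → Bool) (n k kk j : ℕ) (sgn : Bool) (α w : List Bool) : List Bool :=
  let w1 := w.drop (k * n)
  let w2 := w1.drop k
  let w3 := w2.drop (kk * n)
  candStr n kk (hybPred T n j sgn (CondParams.fitLen (w.take (k * n)) (k * n)) (CondParams.fitLen (w1.take k) k) α)
    (CondParams.fitLen (w2.take (kk * n)) (kk * n)) (CondParams.fitLen (w3.take kk) kk)

/-- **The advice function `A(x; w)`**: the inner products of `x` with the first `j` blocks of the coins.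
[cite: Hirahara2021, Lemma 3.14] -/
def advice (x : List Bool) (n k j : ℕ) (w : List Bool) : List Bool :=
  glBits j n x (CondParams.fitLen (w.take (k * n)) (k * n))

/-- The advice has `j` bits. [folklore] -/
@[simp] theorem length_advice (x : List Bool) (n k j : ℕ) (w : List Bool) : (advice x n k j w).length = j :=
  length_glBits _ _ _ _

/-! ### The string predictor is `predZ` -/

/-- The first `j` Goldreich–Levin bits are a prefix of the first `k`. [folklore] -/
theorem glBits_eq_take {j k : ℕ} (hj : j ≤ k) (n : ℕ) (x σ : List Bool) : glBits j n x σ = (glBits k n x σ).take j := by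
  unfold glBits
  rw [← List.map_take, List.take_range, min_eq_left hj]

/-- `encZ` of the hybrid bits: advice prefix, then the coins from `j` on. [folklore] -/
theorem encZ_hyb (j : Fin k) (x : BVec n) (z : Fin k → BVec n) (u : BVec k) :
    encZ k (DPHyb.hyb j x z u) = (encZ k fun i => x ⬝ᵥ z i).take j ++ (encZ k u).drop j := by
  conv_lhs => rw [← List.take_append_drop (j : ℕ) (encZ k (DPHyb.hyb j x z u))]
  congr 1
  · apply List.ext_getElem (by simp)
    intro t h1 h2
    simp only [List.length_take, length_encZ] at h1
    have ht : t < (j : ℕ) := by omega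
    simp only [List.getElem_take, encZ, List.getElem_ofFn, DPHyb.hyb]
    simp [ht]
  · apply List.ext_getElem (by simp)
    intro t h1 h2
    have ht : ¬ ((j : ℕ) + t < (j : ℕ)) := by omega
    simp only [List.getElem_drop, encZ, List.getElem_ofFn, DPHyb.hyb]
    simp [ht]

/-- Block strings with one block replaced. [folklore] -/
theorem blocksStr_update (z : Fin k → BVec n) (j : Fin k) (r : BVec n) :
    blocksStr (Function.update z j r) = (blocksStr z).take (j * n) ++ encZ n r ++ (blocksStr z).drop ((j + 1) * n) := by
  rw [blocksStr_eq_take_append _ j, take_blocksStr_update, drop_blocksStr_update, Function.update_self]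

/-- **The string predictor is Yao's predictor `predZ` of the math layer** on encoded blocks, coins,
advice and query (test `T` read on `blocks ‖ bits`). [cite: Hirahara2021, Lemma 3.14 (proof)] -/
theorem bz_hybPred (T : List Bool → Bool) (j : Fin k) (sgn : Bool) (x : BVec n) (z : Fin k → BVec n) (u : BVec k) (r : BVec n) :
    bz (hybPred T n j sgn (blocksStr z) (encZ k u) ((encZ k fun i => x ⬝ᵥ z i).take j) (encZ n r)) =
      DPHyb.predZ (fun z' u' => T (blocksStr z' ++ encZ k u')) j (bz sgn) x (z, u) r := by
  have key : ∀ (b s : Bool) (c : ZMod 2),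
      bz (!(Bool.xor (decide (c = 1)) (Bool.xor s b))) = (if b = true then c else c + 1) + bz s := by decide
  unfold hybPred DPHyb.predZ
  dsimp only
  simp only [blocksStr_update, encZ_hyb, getD_encZ u j, List.take_of_length_le (length_encZ n r).le, List.append_assoc]
  exact key _ _ _

/-- **The run on split coins.** [folklore] -/
theorem hrun_split (T : List Bool → Bool) (kk j : ℕ) (sgn : Bool) (α : List Bool)
    (ω' : List.Vector Bool (k * n)) (u : List.Vector Bool k) (S : List.Vector Bool (kk * n)) (τ : List.Vector Bool kk) (w : List Bool) :
    hrun T n k kk j sgn α (ω'.toList ++ (u.toList ++ (S.toList ++ (τ.toList ++ w)))) =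
      candStr n kk (hybPred T n j sgn ω'.toList u.toList α) S.toList τ.toList := by
  simp only [hrun]
  simp only [List.take_left' (List.Vector.toList_length _), List.drop_left' (List.Vector.toList_length _),
    CondParams.fitLen_of_length_eq (List.Vector.toList_length _)]

/-- **The advice on split coins** is the first `j` inner products with the blocks. [folklore] -/
theorem advice_split {j : ℕ} (hj : j ≤ k) (x : List.Vector Bool n) (z : Fin k → BVec n) (w : List Bool) :
    advice x.toList n k j (blocksStr z ++ w) = (encZ k fun i => toZ x ⬝ᵥ z i).take j := by
  unfold advice
  rw [List.take_left' (length_blocksStr z), CondParams.fitLen_of_length_eq (length_blocksStr z), glBits_eq_take hj,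
    glBits_blocksStr]

/-! ### The success count -/

/-- **The number of successful coin strings** (run fed with the advice of the same coins, target `x`),
over coins of length `kn + k + kk·n + kk + W`, is at least `2^W` times the success count of the math
layer. [cite: Hirahara2021, Lemma 3.14 (proof)] -/
theorem card_success_ge (T : List Bool → Bool) (kk : ℕ) (j : Fin k) (sgn : Bool) (x : List.Vector Bool n) (W : ℕ) :
    2 ^ W * (univ.filter fun t : ((Fin k → BVec n) × BVec k) × (Fin kk → BVec n) × (Fin kk → ZMod 2) =>
        glCandidate (DPHyb.predZ (fun z' u' => T (blocksStr z' ++ encZ k u')) j (bz sgn) (toZ x) t.1) kk t.2.1 t.2.2 = toZ x).card ≤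
      (univ.filter fun coins : List.Vector Bool (k * n + (k + (kk * n + (kk + W)))) =>
        hrun T n k kk j sgn (advice x.toList n k j coins.toList) coins.toList = x.toList).card := by
  classical
  set I : List Bool → ℕ := fun l => if hrun T n k kk j sgn (advice x.toList n k j l) l = x.toList then 1 else 0 with hI
  rw [Finset.card_filter (fun coins : List.Vector Bool (k * n + (k + (kk * n + (kk + W)))) =>
    hrun T n k kk j sgn (advice x.toList n k j coins.toList) coins.toList = x.toList)]
  change _ ≤ ∑ coins : List.Vector Bool (k * n + (k + (kk * n + (kk + W)))), I coins.toList
  -- peel the four fields and the unused coins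
  have h1 := Literature.Computability.Cryptography.sum_vector_add (M := ℕ) (k * n) (k + (kk * n + (kk + W))) (fun a b => I (a ++ b))
  simp only [List.take_append_drop] at h1
  have h2 : ∀ p : List Bool, ∑ r : List.Vector Bool (k + (kk * n + (kk + W))), I (p ++ r.toList) =
      ∑ u : List.Vector Bool k, ∑ r : List.Vector Bool (kk * n + (kk + W)), I (p ++ (u.toList ++ r.toList)) := fun p => by
    have h := Literature.Computability.Cryptography.sum_vector_add (M := ℕ) k (kk * n + (kk + W)) (fun a b => I (p ++ (a ++ b)))
    simpa only [List.take_append_drop] using h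
  have h3 : ∀ p : List Bool, ∑ r : List.Vector Bool (kk * n + (kk + W)), I (p ++ r.toList) =
      ∑ S : List.Vector Bool (kk * n), ∑ r : List.Vector Bool (kk + W), I (p ++ (S.toList ++ r.toList)) := fun p => by
    have h := Literature.Computability.Cryptography.sum_vector_add (M := ℕ) (kk * n) (kk + W) (fun a b => I (p ++ (a ++ b)))
    simpa only [List.take_append_drop] using h
  have h4 : ∀ p : List Bool, ∑ r : List.Vector Bool (kk + W), I (p ++ r.toList) =
      ∑ τ : List.Vector Bool kk, ∑ w : List.Vector Bool W, I (p ++ (τ.toList ++ w.toList)) := fun p => by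
    have h := Literature.Computability.Cryptography.sum_vector_add (M := ℕ) kk W (fun a b => I (p ++ (a ++ b)))
    simpa only [List.take_append_drop] using h
  rw [h1]
  simp only [← List.append_assoc] at h2 h3 h4 ⊢
  simp only [h2, h3, h4]
  -- the innermost summand: the run on split coins, independent of `w`
  have hrunI : ∀ (ω' : List.Vector Bool (k * n)) (u : List.Vector Bool k) (S : List.Vector Bool (kk * n)) (τ : List.Vector Bool kk)
      (w : List.Vector Bool W),
      I (ω'.toList ++ u.toList ++ S.toList ++ τ.toList ++ w.toList) =
        if candStr n kk (hybPred T n j sgn ω'.toList u.toList (advice x.toList n k j ω'.toList)) S.toList τ.toList = x.toList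
        then 1 else 0 := by
    intro ω' u S τ w
    simp only [hI, List.append_assoc]
    rw [hrun_split]
    have hadv : advice x.toList n k j (ω'.toList ++ (u.toList ++ (S.toList ++ (τ.toList ++ w.toList)))) =
        advice x.toList n k j ω'.toList := by
      unfold advice
      rw [List.take_left' (List.Vector.toList_length _), List.take_of_length_le (List.Vector.toList_length _).le]
    rw [hadv]
  simp only [hrunI, Finset.sum_const, Finset.card_univ, card_vector, Fintype.card_bool, smul_eq_mul]
  -- re-index the fields by the objects of the math layer
  rw [Finset.card_filter, Finset.mul_sum,
    show (∑ ω' : List.Vector Bool (k * n), ∑ u : List.Vector Bool k, ∑ S : List.Vector Bool (kk * n), ∑ τ : List.Vector Bool kk,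
        2 ^ W * (if candStr n kk (hybPred T n j sgn ω'.toList u.toList (advice x.toList n k j ω'.toList)) S.toList τ.toList = x.toList
          then 1 else 0)) =
      ∑ q : (List.Vector Bool (k * n) × List.Vector Bool k) × (List.Vector Bool (kk * n) × List.Vector Bool kk),
        2 ^ W * (if candStr n kk (hybPred T n j sgn q.1.1.toList q.1.2.toList (advice x.toList n k j q.1.1.toList)) q.2.1.toList q.2.2.toList
          = x.toList then 1 else 0) by
      simp only [Fintype.sum_prod_type]]
  refine (Fintype.sum_equiv (Equiv.prodCongr (Equiv.prodCongr (blocksEquiv n k).symm (coinEquiv k))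
    (Equiv.prodCongr (blocksEquiv n kk).symm (coinEquiv kk))) _ _ fun q => ?_).ge
  obtain ⟨⟨ω', u⟩, S, τ⟩ := q
  simp only [Equiv.prodCongr_apply, Prod.map_apply, GLEns.coinEquiv_apply]
  rw [GLInv.toList_eq_blocksStr_symm ω', GLInv.toList_eq_blocksStr_symm S, ← encZ_toZ u, ← encZ_toZ τ]
  congr 1
  refine if_congr ?_ rfl rfl
  -- `candStr = x ↔ glCandidate = toZ x`
  set z := (blocksEquiv n k).symm ω' with hz
  have hadv : advice x.toList n k j (blocksStr z) = (encZ k fun i => toZ x ⬝ᵥ z i).take j := by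
    simpa using advice_split j.isLt.le x z []
  rw [hadv, candStr_eq]
  have hB : (fun r => bz (hybPred T n j sgn (blocksStr z) (encZ k (toZ u)) ((encZ k fun i => toZ x ⬝ᵥ z i).take j) (encZ n r))) =
      DPHyb.predZ (fun z' u' => T (blocksStr z' ++ encZ k u')) j (bz sgn) (toZ x) (z, toZ u) := by
    funext r; exact bz_hybPred T j sgn (toZ x) z (toZ u) r
  rw [hB]
  constructor
  · intro h; exact encZ_injective n (h.trans (encZ_toZ x).symm)
  · intro h; rw [h, encZ_toZ]

/-! ### The success probability -/

/-- `Pr_z[T(DP_k(x; z))] · 2^{kn} = #{z | T(blocks z ‖ real bits)}`. [folklore] -/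
theorem prReal_mul_eq (T : List Bool → Bool) (x : List.Vector Bool n) (k : ℕ) :
    uniformProb (k * n) {z | T (dpGen k x.toList z) = true} * 2 ^ (k * n) =
      (univ.filter fun z : Fin k → BVec n => T (blocksStr z ++ encZ k fun i => toZ x ⬝ᵥ z i) = true).card := by
  classical
  unfold uniformProb
  rw [div_mul_cancel₀ _ (by positivity)]
  congr 1
  refine Finset.card_equiv (blocksEquiv n k).symm fun z => ?_
  simp only [mem_filter, mem_univ, true_and, Set.mem_setOf_eq]
  rw [GLInv.toList_eq_blocksStr_symm z, DPRecon.dpGen_blocksStr]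

/-- `Pr_w[T(w)] · 2^{kn} 2^k = #{(z, u) | T(blocks z ‖ bits u)}`. [folklore] -/
theorem prIdeal_mul_eq (T : List Bool → Bool) (n k : ℕ) :
    uniformProb (k * n + k) {w | T w = true} * (2 ^ (k * n) * 2 ^ k) =
      (univ.filter fun q : (Fin k → BVec n) × BVec k => T (blocksStr q.1 ++ encZ k q.2) = true).card := by
  classical
  unfold uniformProb
  rw [pow_add, div_mul_cancel₀ _ (by positivity)]
  have h := Literature.Computability.Cryptography.sum_vector_add (M := ℕ) (k * n) k (fun u w => if T (u ++ w) = true then 1 else 0)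
  simp only [List.take_append_drop] at h
  rw [Finset.natCast_card_filter, Finset.natCast_card_filter]
  have h' : (∑ z : List.Vector Bool (k * n + k), (if T z.toList = true then 1 else 0 : ℕ)) =
      ∑ q : (Fin k → BVec n) × BVec k, (if T (blocksStr q.1 ++ encZ k q.2) = true then 1 else 0 : ℕ) := by
    rw [h, Fintype.sum_prod_type]
    dsimp only
    rw [GLInv.sum_vector_eq_sum_blocks n k (fun u => ∑ w : List.Vector Bool k, if T (u ++ w.toList) = true then 1 else 0)]
    refine Finset.sum_congr rfl fun σ _ => ?_
    exact GLEns.sum_vector_eq_sum_bvec (M := ℕ) k (fun w => if T (blocksStr σ ++ w) = true then 1 else 0)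
  exact_mod_cast h'

/-- **Lemma 3.14 on strings: the success probability of one run fed with its own advice.** If the test
`T` `δ`-distinguishes `DP_k(x; ·)` from uniform (`dpAdvantage ≥ δ > 0`, `k ≥ 1`) and
`2^kk − 1 ≥ n / (2(δ/4k)²)`, then for some block `j < k` and sign `sgn`,
`Pr_w[hrun (advice x w) w = x] ≥ δ/(8k·2^kk)` over coins of any length `≥ kn + k + kk·n + kk`.
[Hirahara 2021 (ECCC TR21-058), Lemma 3.14 ("`Pr_w[R^D(A(x;w); w) = x] ≥ 1/poly(n/δ)`")]
[cite: Hirahara2021, Lemma 3.14] -/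
theorem exists_uniformProb_hrun_ge (T : List Bool → Bool) (x : List.Vector Bool n) (hk : 0 < k) {δ : ℝ} (hδ : 0 < δ)
    (hadv : δ ≤ dpAdvantage k x.toList T) {kk : ℕ} (hkk : 0 < kk) (hm : (n : ℝ) ≤ 2 * (δ / k / 4) ^ 2 * (2 ^ kk - 1 : ℕ)) (W : ℕ) :
    ∃ (j : ℕ) (_ : j < k) (sgn : Bool),
      δ / k / 8 / 2 ^ kk ≤ uniformProb (k * n + (k + (kk * n + (kk + W))))
        {w | hrun T n k kk j sgn (advice x.toList n k j w) w = x.toList} := by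
  classical
  -- the gap hypothesis of the math layer
  have hgap : δ * Fintype.card ((Fin k → BVec n) × BVec k) ≤
      |2 ^ k * ((univ.filter fun z : Fin k → BVec n => T (blocksStr z ++ encZ k fun i => toZ x ⬝ᵥ z i) = true).card : ℝ) -
        ((univ.filter fun q : (Fin k → BVec n) × BVec k => T (blocksStr q.1 ++ encZ k q.2) = true).card : ℝ)| := by
    have hcard : (Fintype.card ((Fin k → BVec n) × BVec k) : ℝ) = 2 ^ (k * n) * 2 ^ k := by
      rw [Fintype.card_prod, Nat.cast_mul, DPRecon.card_blocks]
      simp only [Fintype.card_fun, Fintype.card_fin, ZMod.card, Nat.cast_pow, Nat.cast_ofNat]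
    rw [hcard, ← prReal_mul_eq T x k, ← prIdeal_mul_eq T n k]
    have h : dpAdvantage k x.toList T = |uniformProb (k * n) {z | T (dpGen k x.toList z) = true} -
        uniformProb (k * n + k) {w | T w = true}| := by
      simp only [dpAdvantage, List.Vector.toList_length, mul_comm n k]
    rw [h] at hadv
    have hpos : (0 : ℝ) ≤ 2 ^ (k * n) * 2 ^ k := by positivity
    have heq : (2 : ℝ) ^ k * (uniformProb (k * n) {z | T (dpGen k x.toList z) = true} * 2 ^ (k * n)) -
        uniformProb (k * n + k) {w | T w = true} * (2 ^ (k * n) * 2 ^ k) =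
        (uniformProb (k * n) {z | T (dpGen k x.toList z) = true} - uniformProb (k * n + k) {w | T w = true}) * (2 ^ (k * n) * 2 ^ k) := by
      ring
    rw [heq, abs_mul, abs_of_nonneg hpos]
    exact mul_le_mul_of_nonneg_right hadv hpos
  obtain ⟨j, sgnZ, hcount⟩ := DPHyb.reconstruction_count (fun z' u' => T (blocksStr z' ++ encZ k u')) (toZ x) hk hδ hgap hkk hm
  -- the sign as a Boolean
  obtain ⟨sgn, hsgn⟩ : ∃ sgn : Bool, bz sgn = sgnZ := by
    rcases (by decide : ∀ c : ZMod 2, c = 0 ∨ c = 1) sgnZ with h | h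
    · exact ⟨false, h ▸ rfl⟩
    · exact ⟨true, h ▸ rfl⟩
  subst hsgn
  refine ⟨j, j.isLt, sgn, ?_⟩
  have hstr := card_success_ge T kk j sgn x W
  have hstr' : (2 : ℝ) ^ W * ((univ.filter fun t : ((Fin k → BVec n) × BVec k) × (Fin kk → BVec n) × (Fin kk → ZMod 2) =>
      glCandidate (DPHyb.predZ (fun z' u' => T (blocksStr z' ++ encZ k u')) j (bz sgn) (toZ x) t.1) kk t.2.1 t.2.2 = toZ x).card : ℝ) ≤
      ((univ.filter fun coins : List.Vector Bool (k * n + (k + (kk * n + (kk + W)))) =>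
        hrun T n k kk j sgn (advice x.toList n k j coins.toList) coins.toList = x.toList).card : ℝ) := by
    exact_mod_cast hstr
  have htot : (Fintype.card (((Fin k → BVec n) × BVec k) × (Fin kk → BVec n) × (Fin kk → ZMod 2)) : ℝ) =
      2 ^ (k * n) * 2 ^ k * 2 ^ (kk * n) * 2 ^ kk := by
    rw [Fintype.card_prod, Fintype.card_prod, Fintype.card_prod, Nat.cast_mul, Nat.cast_mul, Nat.cast_mul, DPRecon.card_blocks,
      DPRecon.card_blocks]
    simp only [Fintype.card_fun, Fintype.card_fin, ZMod.card, Nat.cast_pow, Nat.cast_ofNat]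
    ring
  rw [htot] at hcount
  unfold uniformProb
  rw [le_div_iff₀ (by positivity)]
  refine le_trans ?_ (hstr'.trans (le_of_eq (by congr 2; ext r; simp)))
  have hC2 : (2 : ℝ) ^ (k * n + (k + (kk * n + (kk + W)))) = 2 ^ (k * n) * 2 ^ k * 2 ^ (kk * n) * 2 ^ kk * 2 ^ W := by
    simp only [pow_add]; ring
  rw [hC2]
  calc δ / k / 8 / 2 ^ kk * (2 ^ (k * n) * 2 ^ k * 2 ^ (kk * n) * 2 ^ kk * 2 ^ W)
      = 2 ^ W * (δ / k / 8 / 2 ^ kk * (2 ^ (k * n) * 2 ^ k * 2 ^ (kk * n) * 2 ^ kk)) := by ring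
    _ ≤ _ := mul_le_mul_of_nonneg_left hcount (by positivity)

end DPHybStr

end Literature.Computability.MetaComplexity

end
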